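import Summits.QuantumFields.YangMills.Theorems.BalabanUVNodesN15TwoGridCovariantDefectFactor
import Summits.QuantumFields.YangMills.Theorems.BalabanUVNodesN15TwoGridGluingGeneralTransport
import Summits.QuantumFields.YangMills.Theorems.BalabanUVNodesN15CurvedGluingLocalGaugesTwoGrid
import HarnessLib

/-!
# N15 = NE2, road (c) — PROGRAMME (PC) «[B9] Sect. C FOR THE LANDAU LETTER WITH PER-CUBE GAUGES (3.35) AS PRINTED», (PC-E) (C2) OF THE AMENDED ARCHITECTURE: THE TWO-GRID GLUE IN
# PER-CUBE GAUGES THROUGH A TWISTED TRANSPORT — dag-n15-w2's `…CurvedGluingLocalGaugesTwoGrid` with the flat pull-back replaced by a transport `T = M_{W′_□ᵀ}(M_{S_□ᵀ}∘pull)M_{W′_□∘σ}`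
# (per cube: fine gauge `W′_□`, INDUCED coarse gauge `W′_□∘σ`, staircase field `S_□`), NO gauge fit: the per-piece interface n15-c∕331 §5 + the transport-generic glue n15-c∕332
# (dag-n15-c g31, n15-c∕333)

Cell `pub-ymgap`, seat `pub-ymgap-dag-n15-c` (generation g31; R134 (a) seat, strategy s1 «first missing estimate»; HUMAN RULING D-0062; chair R424 venue).
`bears_on: R4∕N15 · K3⁸ SpineGivenEndpointR13SepCoPHV (stmt-QuantumFields-27366)`; filed `--kind proof --supports stmt-QuantumFields-27366 --as helper` — COUNT-NEUTRAL.
Theorems only, 0 `def`, 0 `sorry`; bookkeeping over landed rows, NO new estimate.  Imports BY NAME n15-c∕331 `…TwoGridCovariantDefectFactor` (`idef_mul_split`; through it 330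
`idef_conj`), n15-c∕332 `…TwoGridGluingGeneralTransport` (★★★★ `hasMaj_idef_glued_of_cutRows_defect_tr`), dag-n15-w2 `…CurvedGluingLocalGaugesTwoGrid` (through it
`…CurvedGluingLocalGauges`: `cutRow_of_localGauge`, `commRow_of_localGauge`, `defectRow_of_localGauge`, `mulOp_comp_gaugeConj`; `…CubeDressedGeneralGauge`:
`hasMaj_mmulOp_comp_of_entry_le_one`, `hasMaj_comp_mmulOp_of_entry_le_one`, `entry_le_one_of_orthogonal`, `transpose_entry_le_one_of_orthogonal`; dag-n15-w4
`MatrixSpecies.loc_fine_mmul_pull_le`), pub-balaban `T4EtaRateDefect`∕`T4EtaRateCoeffDefect`.  Nothing in the tree is modified, no landed name re-declared.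

WHY (director-ym I.20907: architecture of record = `PCE-DESIGN-g31.md` §5 (3) «53-knit ∕ `idef_fix` two-grid walk with COVARIANT τ per piece and per-piece cube gauge pairs»;
§6: floor-free for two-sided localized pieces).  dag-n15-w2's two-grid glue in per-cube gauges needs the FLAT gauge fit `|W′_□ − W_□∘π| ≤ o_W`, false for rough pairs (memo §2
witness).  With the covariant transport of the ruling the fit DISAPPEARS: `T = τ_{U′}` factors per cube as `M_{W′_□ᵀ}∘(M_{S_□ᵀ}∘pull)∘M_{W′_□∘σ}` (n15-c∕331 `ctauV_eq_conj_gaugeTb`,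
dag-n15-a `ctauV_gauge`), `S_□ = ` the staircase field of the gauge-transformed datum, `S_□ − 1` small ON THE CUBE's BOX (dag-n15-a ✓p793284); n15-c∕331 `idef_ctauV_conj_split`
turns the `T`-defect of the conjugated pieces into `M_{W′ᵀ}[𝔇_{pull}(X′,X) + X′(M_{Sᵀ}−1)pull − (M_{Sᵀ}−1)pull X]M_{W′σ}`, and the two extra terms are small when the piece is
localized where `S − 1` is (memo §6).  THIS FILE types that per-piece conversion GENERICALLY (abstract carriers, §2 ★★★ `hasMaj_idef_conj_tr`: flat defect row `K_D`, piece rows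
`K′, K`, support identities and SMEARED stair letters `Σ_j|(ψ·(Sᵀ−1))_{ij}| ≤ s` ⟹ the `T`-defect row `|κ|²(K_D + sK′ + sK)` of the conjugated pair), instantiates it for the three
piece types of the walk (§3), supplies the partition-defect row of n15-c∕332 for `T = M_{Ψᵀ}∘pull` (§3 `hasMaj_idef_mulOp_tr`, `|κ|·o`), and assembles ★★★★
`hasMaj_idef_glued_of_localGauges_tr` (§4) = dag-n15-w2's `hasMaj_idef_glued_of_localGauges` with `pull ↦ T`, fine gauges `W′_□`, coarse gauges `W′_□∘σ`, NO gauge fit, at the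
cost `m ↦ m + 2βs`, `r ↦ r + 2θ₀s`, `r_E ↦ r_E + 2εs`, `o ↦ |κ|o` in the constants.  The site∕bond instantiation (53's covariant edition for the scalar covariant Green's function
`G′(U)`, (PC-E-A)) follows with dag-n15-a's (m4)-A cut rows.

HONEST FRAMING ∕ LIMITS.  Bookkeeping over landed rows; all piece rows, flat defects, support identities and stair letters are HYPOTHESES (their producers: dag-n15-w3 52∕53's piece
files, dag-n15-a's (m4)-A `…PerCubeGreenTwoGridCutRows`, ✓p793284); no pairing between the two grids' fields is assumed here; MODEL carriers; [Balaban1984PropagatorsII] (2.91)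
p.239, (2.133)–(2.136) p.247, [Balaban1985BackgroundPropagators] (3.34)–(3.35) p.396, (3.87)–(3.90) pp.409–410, Thm 3.14 pp.426–427, [King1986] p.664 = MECHANISM ∕ TEMPLATE,
nothing printed is asserted.  NE2⁺ NOT PRINTED, NOT proved; N15 of record untouched (DISCHARGED AS CONSUMED, p687738); K3⁸ OPEN; counts of record UNMOVED (typed 28∕28 ·
discharged 8∕27); one finite 𝕋⁴ at fixed ε per index — NOT infinite volume, NOT OS on ℝ⁴, NOT a mass gap, NOT Clay; R4 closes the conditional finite-𝕋⁴ rung `BalabanLadder.UV` only.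
-/

set_option autoImplicit false

noncomputable section
open scoped BigOperators Matrix
open Finset

namespace Summit.QuantumFields.YangMills.BalabanUVNodes.N15.CurvedSpecies

open Literature.MathematicalPhysics.QuantumFieldTheory.Balaban1983to89
open Literature.MathematicalPhysics.QuantumFieldTheory.Balaban1983to89.B11SectG (BlockNorm HasMaj RowSum)
open Literature.MathematicalPhysics.QuantumFieldTheory.Balaban1983to89.B6RandomWalk (Triangle254)
open Literature.MathematicalPhysics.QuantumFieldTheory.Balaban1983to89.T4EtaRateDefect (idef idef_comp idef_add idef_sub)
open Literature.MathematicalPhysics.QuantumFieldTheory.Balaban1983to89.T4EtaRateCoeffDefect (pull pull_apply diagK diagK_nonneg hasMaj_mulOp hasMaj_idef_mulOp)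
open Literature.MathematicalPhysics.QuantumFieldTheory.Balaban1983to89.B6Prop26Gluing (mulOp mulOp_apply ind ind_nonneg ind_le_one)
open Summit.QuantumFields.YangMills.BalabanUVNodes.N15.MatrixSpecies (mmulOp mmulOp_apply liftBlk liftMap loc_fine_mmul_pull_le)
open Summit.QuantumFields.YangMills.BalabanUVNodes.N15.Gluing (commOp parametrix remainder glueInv hasMaj_comp_diag hasMaj_diag_comp idef_conj idef_mul_split
  hasMaj_idef_glued_of_cutRows_defect_tr)

/-! ## §1 Helpers: matrix multipliers against the block pull-back and against colour-blind scalars -/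

section Helpers

variable {X X' κ : Type} [Fintype X] [Fintype X'] [Fintype κ] [DecidableEq κ] {g : B6.Geometry} (blk : X → g.Site) (π : X' → X)

omit [DecidableEq κ] in
/-- `M_c ∘ pull` has the diagonal majorant `diag o` when `Σ_j|c(x′)_{ij}| ≤ o(blk(πx′))` (dag-n15-w4's one estimate `loc_fine_mmul_pull_le` in `HasMaj` form). [folklore] -/
theorem hasMaj_mmulOp_pull {c : X' → Matrix κ κ ℝ} {o : g.Site → ℝ} (ho : ∀ y, 0 ≤ o y) (hc : ∀ x' i, ∑ j, |c x' i j| ≤ o (blk (π x'))) :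
    HasMaj (BlockNorm.ofBlocks g (liftBlk blk κ)) (BlockNorm.ofBlocks g (liftBlk (blk ∘ π) κ)) (mmulOp c ∘ₗ pull (liftMap π κ)) (diagK o) := by
  intro y' μ hμ y
  exact loc_fine_mmul_pull_le blk π ho hc hμ y

omit [Fintype X] [Fintype X'] [Fintype κ] [DecidableEq κ] in
/-- Colour-blind scalars pass through the block pull-back: `pull ∘ M_{a∘fst} = M_{a∘π∘fst} ∘ pull`. [folklore] -/
theorem pull_comp_mulOp_fst (a : X → ℝ) :
    pull (liftMap π κ) ∘ₗ mulOp (fun p : X × κ => a p.1) = mulOp (fun p' : X' × κ => (a ∘ π) p'.1) ∘ₗ pull (liftMap π κ) := by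
  refine LinearMap.ext fun f => funext fun p' => ?_
  simp [mulOp, pull]

omit [Fintype X] [Fintype X'] [DecidableEq κ] in
/-- A colour-blind scalar after a matrix multiplier is the smeared matrix multiplier: `M_{a∘fst} ∘ M_C = M_{a·C}`. [folklore] -/
theorem mulOp_fst_comp_mmulOp_smul (a : X' → ℝ) (C : X' → Matrix κ κ ℝ) :
    mulOp (fun p : X' × κ => a p.1) ∘ₗ mmulOp C = mmulOp (fun x' => a x' • C x') := by
  refine LinearMap.ext fun f => funext fun p => ?_
  simp only [LinearMap.comp_apply, mulOp_apply, mmulOp_apply, Matrix.smul_apply, smul_eq_mul, Finset.mul_sum]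
  exact Finset.sum_congr rfl fun j _ => by ring

omit [Fintype X] [Fintype X'] [DecidableEq κ] in
/-- … and before it: `M_C ∘ M_{a∘fst} = M_{a·C}`. [folklore] -/
theorem mmulOp_comp_mulOp_fst_smul (a : X' → ℝ) (C : X' → Matrix κ κ ℝ) :
    mmulOp C ∘ₗ mulOp (fun p : X' × κ => a p.1) = mmulOp (fun x' => a x' • C x') := by
  refine LinearMap.ext fun f => funext fun p => ?_
  simp only [LinearMap.comp_apply, mmulOp_apply, mulOp_apply, Matrix.smul_apply, smul_eq_mul]
  exact Finset.sum_congr rfl fun j _ => by ring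

omit [Fintype X] [Fintype X'] in
/-- `M_C − 1 = M_{C − 1}`. [folklore] -/
theorem mmulOp_sub_id (C : X' → Matrix κ κ ℝ) : mmulOp C - LinearMap.id = mmulOp (fun x' => C x' - 1) := by
  refine LinearMap.ext fun f => funext fun p => ?_
  simp only [LinearMap.sub_apply, LinearMap.id_apply, mmulOp_apply, Matrix.sub_apply, sub_mul, Finset.sum_sub_distrib, Pi.sub_apply]
  congr 1
  rw [Finset.sum_eq_single p.2 (fun j _ hj => by rw [Matrix.one_apply_ne' hj, zero_mul]) (fun h => (h (Finset.mem_univ _)).elim), Matrix.one_apply_eq, one_mul]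

end Helpers

/-! ## §2 The per-piece conversion: twisted-transport defect of gauge-conjugated pieces -/

section Piece

variable {X X' κ : Type} [Fintype X] [Fintype X'] [DecidableEq X] [DecidableEq X'] [Fintype κ] [DecidableEq κ] {g : B6.Geometry} (blk : X → g.Site) (π : X' → X) (sec : X → X')
  (T : (X × κ → ℝ) →ₗ[ℝ] (X' × κ → ℝ)) (W' Sg : X' → Matrix κ κ ℝ)

omit [DecidableEq X] [DecidableEq X'] in
/-- ★★★ **THE PER-PIECE CONVERSION** (memo §5–§6; n15-c∕331 §5 in `HasMaj` form, generic carriers).  Transport `T = M_{W′ᵀ}(M_{Sᵀ}∘pull)M_{W′∘σ}` (`W′` orthogonal); fine piece `Y′`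
with row `K′` and input support `ψ′`, coarse piece `Y` with row `K` and output support `ψ`; flat defect `𝔇_{pull}(Y′, Y) ≤ K_D`; SMEARED stair letters `Σ_j|(ψ′·(Sᵀ−1))_{ij}|,
Σ_j|((ψ∘π)·(Sᵀ−1))_{ij}| ≤ s` ⟹ `𝔇_T(M_{W′ᵀ}Y′M_{W′}, M_{(W′σ)ᵀ}YM_{W′σ}) ≤ |κ|²·(K_D + s·K′ + s·K)`. [cite: Balaban1985BackgroundPropagators, (3.34)–(3.35) p.396, Thm 3.14 pp.426–427
(difference template: shape); Balaban1984PropagatorsII, (2.133)–(2.136) p.247 (mechanism); King1986, p.664 (pairing)] -/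
theorem hasMaj_idef_conj_tr (hW'1 : ∀ v, (W' v)ᵀ * W' v = 1) (hW'2 : ∀ v, W' v * (W' v)ᵀ = 1)
    (hT : T = mmulOp (fun x' => (W' x')ᵀ) ∘ₗ (mmulOp (fun x' => (Sg x')ᵀ) ∘ₗ pull (liftMap π κ)) ∘ₗ mmulOp (fun x => W' (sec x)))
    {Y' : (X' × κ → ℝ) →ₗ[ℝ] (X' × κ → ℝ)} {Y : (X × κ → ℝ) →ₗ[ℝ] (X × κ → ℝ)} {ψ' : X' → ℝ} {ψ : X → ℝ} {s : ℝ} (hs : 0 ≤ s)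
    (hYin : Y' ∘ₗ mulOp (fun p : X' × κ => ψ' p.1) = Y') (hYout : mulOp (fun p : X × κ => ψ p.1) ∘ₗ Y = Y)
    (hSin : ∀ x' i, ∑ j, |(ψ' x' • ((Sg x')ᵀ - 1)) i j| ≤ s) (hSout : ∀ x' i, ∑ j, |(ψ (π x') • ((Sg x')ᵀ - 1)) i j| ≤ s)
    {K' K KD : g.Site → g.Site → ℝ} (hK' : ∀ a b, 0 ≤ K' a b) (hK : ∀ a b, 0 ≤ K a b) (hKD : ∀ a b, 0 ≤ KD a b)
    (hY' : HasMaj (BlockNorm.ofBlocks g (liftBlk (blk ∘ π) κ)) (BlockNorm.ofBlocks g (liftBlk (blk ∘ π) κ)) Y' K')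
    (hY : HasMaj (BlockNorm.ofBlocks g (liftBlk blk κ)) (BlockNorm.ofBlocks g (liftBlk blk κ)) Y K)
    (hD : HasMaj (BlockNorm.ofBlocks g (liftBlk blk κ)) (BlockNorm.ofBlocks g (liftBlk (blk ∘ π) κ)) (idef (pull (liftMap π κ)) (pull (liftMap π κ)) Y' Y) KD) :
    HasMaj (BlockNorm.ofBlocks g (liftBlk blk κ)) (BlockNorm.ofBlocks g (liftBlk (blk ∘ π) κ))
      (idef T T (mmulOp (fun x' => (W' x')ᵀ) ∘ₗ Y' ∘ₗ mmulOp W') (mmulOp (fun x => (W' (sec x))ᵀ) ∘ₗ Y ∘ₗ mmulOp (fun x => W' (sec x))))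
      (fun y y' => (Fintype.card κ : ℝ) ^ 2 * (KD y y' + s * K' y y' + s * K y y')) := by
  -- the algebra: conjugation out (330 `idef_conj`), then the multiplier split (331 `idef_mul_split`)
  rw [hT, idef_conj _ _ Y' Y (mmulOp (fun x' => (W' x')ᵀ)) (mmulOp W') (mmulOp (fun x' => (W' x')ᵀ)) (mmulOp (fun x => (W' (sec x))ᵀ))
      (mmulOp (fun x => W' (sec x))) (mmulOp (fun x => W' (sec x))) (mmulOp_comp_transpose W' hW'2) (mmulOp_comp_transpose (fun x => W' (sec x)) fun x => hW'2 _),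
    idef_mul_split]
  -- the two stair terms through the supports
  have eL : Y' ∘ₗ (mmulOp (fun x' => (Sg x')ᵀ) - LinearMap.id) ∘ₗ pull (liftMap π κ) =
      Y' ∘ₗ (mmulOp (fun x' => ψ' x' • ((Sg x')ᵀ - 1)) ∘ₗ pull (liftMap π κ)) := by
    have e1 : Y' ∘ₗ (mmulOp (fun x' => (Sg x')ᵀ) - LinearMap.id) ∘ₗ pull (liftMap π κ) =
        (Y' ∘ₗ mulOp (fun p : X' × κ => ψ' p.1)) ∘ₗ ((mmulOp (fun x' => (Sg x')ᵀ) - LinearMap.id) ∘ₗ pull (liftMap π κ)) := by rw [hYin]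
    rw [e1, LinearMap.comp_assoc, ← LinearMap.comp_assoc (pull (liftMap π κ)) (mmulOp (fun x' => (Sg x')ᵀ) - LinearMap.id) (mulOp (fun p : X' × κ => ψ' p.1)),
      mmulOp_sub_id, mulOp_fst_comp_mmulOp_smul]
  have eR : (mmulOp (fun x' => (Sg x')ᵀ) - LinearMap.id) ∘ₗ pull (liftMap π κ) ∘ₗ Y =
      (mmulOp (fun x' => (ψ ∘ π) x' • ((Sg x')ᵀ - 1)) ∘ₗ pull (liftMap π κ)) ∘ₗ Y := by
    have e1 : (mmulOp (fun x' => (Sg x')ᵀ) - LinearMap.id) ∘ₗ pull (liftMap π κ) ∘ₗ Y =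
        (mmulOp (fun x' => (Sg x')ᵀ) - LinearMap.id) ∘ₗ pull (liftMap π κ) ∘ₗ (mulOp (fun p : X × κ => ψ p.1) ∘ₗ Y) := by rw [hYout]
    rw [e1, ← LinearMap.comp_assoc Y (mulOp (fun p : X × κ => ψ p.1)) (pull (liftMap π κ)), pull_comp_mulOp_fst,
      LinearMap.comp_assoc Y, ← LinearMap.comp_assoc (pull (liftMap π κ) ∘ₗ Y) (mulOp (fun p' : X' × κ => (ψ ∘ π) p'.1)) (mmulOp (fun x' => (Sg x')ᵀ) - LinearMap.id),
      mmulOp_sub_id, mmulOp_comp_mulOp_fst_smul, ← LinearMap.comp_assoc Y (pull (liftMap π κ))]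
  have hML := hasMaj_mmulOp_pull blk π (κ := κ) (o := fun _ => s) (fun _ => hs) (fun x' i => hSin x' i)
  have hMR := hasMaj_mmulOp_pull blk π (κ := κ) (c := fun x' => (ψ ∘ π) x' • ((Sg x')ᵀ - 1)) (o := fun _ => s) (fun _ => hs) (fun x' i => hSout x' i)
  have t1 : HasMaj (BlockNorm.ofBlocks g (liftBlk blk κ)) (BlockNorm.ofBlocks g (liftBlk (blk ∘ π) κ))
      (Y' ∘ₗ (mmulOp (fun x' => (Sg x')ᵀ) - LinearMap.id) ∘ₗ pull (liftMap π κ)) (fun y y' => K' y y' * s) := by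
    rw [eL]
    exact hasMaj_comp_diag (liftBlk (blk ∘ π) κ) hK' hY' hML
  have t2 : HasMaj (BlockNorm.ofBlocks g (liftBlk blk κ)) (BlockNorm.ofBlocks g (liftBlk (blk ∘ π) κ))
      ((mmulOp (fun x' => (Sg x')ᵀ) - LinearMap.id) ∘ₗ pull (liftMap π κ) ∘ₗ Y) (fun y y' => s * K y y') := by
    rw [eR]
    exact hasMaj_diag_comp (liftBlk blk κ) (fun _ => hs) hMR hY
  have hin : HasMaj (BlockNorm.ofBlocks g (liftBlk blk κ)) (BlockNorm.ofBlocks g (liftBlk (blk ∘ π) κ))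
      (idef (pull (liftMap π κ)) (pull (liftMap π κ)) Y' Y +
        (Y' ∘ₗ (mmulOp (fun x' => (Sg x')ᵀ) - LinearMap.id) ∘ₗ pull (liftMap π κ) - (mmulOp (fun x' => (Sg x')ᵀ) - LinearMap.id) ∘ₗ pull (liftMap π κ) ∘ₗ Y))
      (fun y y' => KD y y' + s * K' y y' + s * K y y') := by
    refine (hD.add (t1.sub t2)).mono fun y y' => le_of_eq ?_
    ring
  -- the gauge sandwich
  have h1 := hasMaj_comp_mmulOp_of_entry_le_one blk (b := BlockNorm.ofBlocks g (liftBlk (blk ∘ π) κ)) (W' := fun x => W' (sec x))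
    (fun y y' => by have := hKD y y'; have := hK' y y'; have := hK y y'; positivity) (fun x i j => entry_le_one_of_orthogonal (fun x => hW'2 (sec x)) x i j) hin
  refine (hasMaj_mmulOp_comp_of_entry_le_one (blk ∘ π) (b := BlockNorm.ofBlocks g (liftBlk blk κ)) (W₀ := fun x' => (W' x')ᵀ)
    (fun x' i j => transpose_entry_le_one_of_orthogonal hW'1 x' i j) h1).mono fun y y' => le_of_eq ?_
  ring

end Piece

/-! ## §3 The three piece types of the walk, and the partition-defect row of the twisted transport -/

section Pieces

variable {X X' κ K : Type} [Fintype X] [Fintype X'] [DecidableEq X] [DecidableEq X'] [Fintype κ] [DecidableEq κ] [Fintype K] {g : B6.Geometry}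
  (blk : X → g.Site) (π : X' → X) (sec : X → X') (S : K → Set g.Site) (T : (X × κ → ℝ) →ₗ[ℝ] (X' × κ → ℝ)) (W' St : K → X' → Matrix κ κ ℝ)
  {Δ : (X × κ → ℝ) →ₗ[ℝ] (X × κ → ℝ)} {Δ' : (X' × κ → ℝ) →ₗ[ℝ] (X' × κ → ℝ)} {G' E' : K → (X × κ → ℝ) →ₗ[ℝ] (X × κ → ℝ)}
  {G'' E'' : K → (X' × κ → ℝ) →ₗ[ℝ] (X' × κ → ℝ)} {χX hX ψout : K → X → ℝ} {χX' hX' ψin' : K → X' → ℝ}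

omit [DecidableEq X] [DecidableEq X'] [Fintype K] in
/-- ★★ **CUT-PIECE DEFECTS, TWISTED**: flat cube-gauge defect `𝔇_{pull}(χ′G″, χG′) ≤ 1_S1_S me^{−δd}`, the pieces' cut rows `β`, fine input support `ψ′_in`, coarse output support `ψ_out`,
smeared stair letters `s` ⟹ `𝔇_T(χ′·M_{W′ᵀ}G″M_{W′}, χ·M_{(W′σ)ᵀ}G′M_{W′σ}) ≤ 1_S1_S·|κ|²(m + 2sβ)·e^{−δd}`. [cite: Balaban1985BackgroundPropagators, (3.34)–(3.35) p.396, Thm 3.14 pp.426–427 (shape);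
Balaban1984PropagatorsII, (2.133) p.247] -/
theorem cutDefect_of_localGauge_tr (hW'1 : ∀ k v, (W' k v)ᵀ * W' k v = 1) (hW'2 : ∀ k v, W' k v * (W' k v)ᵀ = 1) {β m s δ : ℝ} (hβ : 0 ≤ β) (hm : 0 ≤ m) (hs : 0 ≤ s) (k : K)
    (hTk : T = mmulOp (fun x' => (W' k x')ᵀ) ∘ₗ (mmulOp (fun x' => (St k x')ᵀ) ∘ₗ pull (liftMap π κ)) ∘ₗ mmulOp (fun x => W' k (sec x)))
    (hGin' : G'' k ∘ₗ mulOp (fun p : X' × κ => ψin' k p.1) = G'' k)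
    (hGout : mulOp (fun p : X × κ => ψout k p.1) ∘ₗ (mulOp (fun p : X × κ => χX k p.1) ∘ₗ G' k) = mulOp (fun p : X × κ => χX k p.1) ∘ₗ G' k)
    (hSin : ∀ x' i, ∑ j, |(ψin' k x' • ((St k x')ᵀ - 1)) i j| ≤ s) (hSout : ∀ x' i, ∑ j, |(ψout k (π x') • ((St k x')ᵀ - 1)) i j| ≤ s)
    (hGc : HasMaj (BlockNorm.ofBlocks g (liftBlk blk κ)) (BlockNorm.ofBlocks g (liftBlk blk κ)) (mulOp (fun p : X × κ => χX k p.1) ∘ₗ G' k)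
      (fun y y' => ind (S k) y * ind (S k) y' * (β * Real.exp (-(δ * g.dist y y')))))
    (hGc' : HasMaj (BlockNorm.ofBlocks g (liftBlk (blk ∘ π) κ)) (BlockNorm.ofBlocks g (liftBlk (blk ∘ π) κ)) (mulOp (fun p : X' × κ => χX' k p.1) ∘ₗ G'' k)
      (fun y y' => ind (S k) y * ind (S k) y' * (β * Real.exp (-(δ * g.dist y y')))))
    (hD : HasMaj (BlockNorm.ofBlocks g (liftBlk blk κ)) (BlockNorm.ofBlocks g (liftBlk (blk ∘ π) κ))
      (idef (pull (liftMap π κ)) (pull (liftMap π κ)) (mulOp (fun p : X' × κ => χX' k p.1) ∘ₗ G'' k) (mulOp (fun p : X × κ => χX k p.1) ∘ₗ G' k))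
      (fun y y' => ind (S k) y * ind (S k) y' * (m * Real.exp (-(δ * g.dist y y'))))) :
    HasMaj (BlockNorm.ofBlocks g (liftBlk blk κ)) (BlockNorm.ofBlocks g (liftBlk (blk ∘ π) κ))
      (idef T T (mulOp (fun p : X' × κ => χX' k p.1) ∘ₗ (mmulOp (fun x' => (W' k x')ᵀ) ∘ₗ G'' k ∘ₗ mmulOp (W' k)))
        (mulOp (fun p : X × κ => χX k p.1) ∘ₗ (mmulOp (fun x => (W' k (sec x))ᵀ) ∘ₗ G' k ∘ₗ mmulOp (fun x => W' k (sec x)))))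
      (fun y y' => ind (S k) y * ind (S k) y' * ((Fintype.card κ : ℝ) ^ 2 * (m + s * β + s * β) * Real.exp (-(δ * g.dist y y')))) := by
  have e := mulOp_comp_gaugeConj (fun x => (W' k (sec x))ᵀ) (χX k) (G' k)
  have e' := mulOp_comp_gaugeConj (fun x' => (W' k x')ᵀ) (χX' k) (G'' k)
  simp only [Matrix.transpose_transpose] at e e'
  rw [show (fun x' => W' k x') = W' k from rfl] at e'
  rw [e, e']
  have hYin : (mulOp (fun p : X' × κ => χX' k p.1) ∘ₗ G'' k) ∘ₗ mulOp (fun p : X' × κ => ψin' k p.1) = mulOp (fun p : X' × κ => χX' k p.1) ∘ₗ G'' k := by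
    rw [LinearMap.comp_assoc, hGin']
  have hE : ∀ y y' : g.Site, 0 ≤ Real.exp (-(δ * g.dist y y')) := fun _ _ => Real.exp_nonneg _
  have h := hasMaj_idef_conj_tr blk π sec T (W' k) (St k) (hW'1 k) (hW'2 k) hTk hs hYin hGout hSin hSout
    (fun a b => mul_nonneg (mul_nonneg (ind_nonneg _ a) (ind_nonneg _ b)) (mul_nonneg hβ (hE a b)))
    (fun a b => mul_nonneg (mul_nonneg (ind_nonneg _ a) (ind_nonneg _ b)) (mul_nonneg hβ (hE a b)))
    (fun a b => mul_nonneg (mul_nonneg (ind_nonneg _ a) (ind_nonneg _ b)) (mul_nonneg hm (hE a b))) hGc' hGc hD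
  exact h.mono fun y y' => le_of_eq (by ring)

omit [DecidableEq X] [DecidableEq X'] [Fintype K] in
/-- ★★ **COMMUTATOR-PIECE DEFECTS, TWISTED**: the cube-gauge commutator pieces' flat defect `1_S(y′)re^{−δd}`, their rows `θ₀`, supports and smeared stair letters ⟹
`𝔇_T([Δ′, M_{h′}](M_{W′ᵀ}G″M_{W′}), [Δ, M_h](M_{(W′σ)ᵀ}G′M_{W′σ})) ≤ 1_S(y′)·|κ|²(r + 2sθ₀)·e^{−δd}`. [cite: Balaban1984PropagatorsII, (2.93) p.239 (shape); Balaban1985BackgroundPropagators,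
(3.34) p.396, Thm 3.14 pp.426–427] -/
theorem commDefect_of_localGauge_tr (hW'1 : ∀ k v, (W' k v)ᵀ * W' k v = 1) (hW'2 : ∀ k v, W' k v * (W' k v)ᵀ = 1) {θ₀ r s δ : ℝ} (hθ : 0 ≤ θ₀) (hr : 0 ≤ r) (hs : 0 ≤ s) (k : K)
    (hTk : T = mmulOp (fun x' => (W' k x')ᵀ) ∘ₗ (mmulOp (fun x' => (St k x')ᵀ) ∘ₗ pull (liftMap π κ)) ∘ₗ mmulOp (fun x => W' k (sec x)))
    (hGin' : G'' k ∘ₗ mulOp (fun p : X' × κ => ψin' k p.1) = G'' k)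
    (hKout : mulOp (fun p : X × κ => ψout k p.1) ∘ₗ (commOp (mmulOp (fun x => W' k (sec x)) ∘ₗ Δ ∘ₗ mmulOp (fun x => (W' k (sec x))ᵀ)) (fun p : X × κ => hX k p.1) ∘ₗ G' k) =
      commOp (mmulOp (fun x => W' k (sec x)) ∘ₗ Δ ∘ₗ mmulOp (fun x => (W' k (sec x))ᵀ)) (fun p : X × κ => hX k p.1) ∘ₗ G' k)
    (hSin : ∀ x' i, ∑ j, |(ψin' k x' • ((St k x')ᵀ - 1)) i j| ≤ s) (hSout : ∀ x' i, ∑ j, |(ψout k (π x') • ((St k x')ᵀ - 1)) i j| ≤ s)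
    (hK : HasMaj (BlockNorm.ofBlocks g (liftBlk blk κ)) (BlockNorm.ofBlocks g (liftBlk blk κ))
      (commOp (mmulOp (fun x => W' k (sec x)) ∘ₗ Δ ∘ₗ mmulOp (fun x => (W' k (sec x))ᵀ)) (fun p : X × κ => hX k p.1) ∘ₗ G' k) (fun y y' => ind (S k) y' * (θ₀ * Real.exp (-(δ * g.dist y y')))))
    (hK' : HasMaj (BlockNorm.ofBlocks g (liftBlk (blk ∘ π) κ)) (BlockNorm.ofBlocks g (liftBlk (blk ∘ π) κ))
      (commOp (mmulOp (W' k) ∘ₗ Δ' ∘ₗ mmulOp (fun x' => (W' k x')ᵀ)) (fun p : X' × κ => hX' k p.1) ∘ₗ G'' k) (fun y y' => ind (S k) y' * (θ₀ * Real.exp (-(δ * g.dist y y')))))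
    (hD : HasMaj (BlockNorm.ofBlocks g (liftBlk blk κ)) (BlockNorm.ofBlocks g (liftBlk (blk ∘ π) κ))
      (idef (pull (liftMap π κ)) (pull (liftMap π κ))
        (commOp (mmulOp (W' k) ∘ₗ Δ' ∘ₗ mmulOp (fun x' => (W' k x')ᵀ)) (fun p : X' × κ => hX' k p.1) ∘ₗ G'' k)
        (commOp (mmulOp (fun x => W' k (sec x)) ∘ₗ Δ ∘ₗ mmulOp (fun x => (W' k (sec x))ᵀ)) (fun p : X × κ => hX k p.1) ∘ₗ G' k))
      (fun y y' => ind (S k) y' * (r * Real.exp (-(δ * g.dist y y'))))) :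
    HasMaj (BlockNorm.ofBlocks g (liftBlk blk κ)) (BlockNorm.ofBlocks g (liftBlk (blk ∘ π) κ))
      (idef T T (commOp Δ' (fun p : X' × κ => hX' k p.1) ∘ₗ (mmulOp (fun x' => (W' k x')ᵀ) ∘ₗ G'' k ∘ₗ mmulOp (W' k)))
        (commOp Δ (fun p : X × κ => hX k p.1) ∘ₗ (mmulOp (fun x => (W' k (sec x))ᵀ) ∘ₗ G' k ∘ₗ mmulOp (fun x => W' k (sec x)))))
      (fun y y' => ind (S k) y' * ((Fintype.card κ : ℝ) ^ 2 * (r + s * θ₀ + s * θ₀) * Real.exp (-(δ * g.dist y y')))) := by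
  have hV' : ∀ x, ((W' k (sec x))ᵀ)ᵀ * (W' k (sec x))ᵀ = 1 := fun x => by rw [Matrix.transpose_transpose]; exact hW'2 k (sec x)
  have hV'' : ∀ x', ((W' k x')ᵀ)ᵀ * (W' k x')ᵀ = 1 := fun x' => by rw [Matrix.transpose_transpose]; exact hW'2 k x'
  have e := commOp_comp_gaugeConj (fun x => (W' k (sec x))ᵀ) hV' (hX k) (mmulOp (fun x => W' k (sec x)) ∘ₗ Δ ∘ₗ mmulOp (fun x => (W' k (sec x))ᵀ)) (G' k)
  have e' := commOp_comp_gaugeConj (fun x' => (W' k x')ᵀ) hV'' (hX' k) (mmulOp (W' k) ∘ₗ Δ' ∘ₗ mmulOp (fun x' => (W' k x')ᵀ)) (G'' k)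
  simp only [Matrix.transpose_transpose] at e e'
  rw [transpose_gaugeConj_cancel (fun x => W' k (sec x)) (fun x => hW'1 k (sec x)) Δ] at e
  rw [show (fun x' => W' k x') = W' k from rfl, transpose_gaugeConj_cancel (W' k) (hW'1 k) Δ'] at e'
  rw [e, e']
  have hYin : (commOp (mmulOp (W' k) ∘ₗ Δ' ∘ₗ mmulOp (fun x' => (W' k x')ᵀ)) (fun p : X' × κ => hX' k p.1) ∘ₗ G'' k) ∘ₗ mulOp (fun p : X' × κ => ψin' k p.1) =
      commOp (mmulOp (W' k) ∘ₗ Δ' ∘ₗ mmulOp (fun x' => (W' k x')ᵀ)) (fun p : X' × κ => hX' k p.1) ∘ₗ G'' k := by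
    rw [LinearMap.comp_assoc, hGin']
  have hE : ∀ y y' : g.Site, 0 ≤ Real.exp (-(δ * g.dist y y')) := fun _ _ => Real.exp_nonneg _
  have h := hasMaj_idef_conj_tr blk π sec T (W' k) (St k) (hW'1 k) (hW'2 k) hTk hs hYin hKout hSin hSout
    (fun a b => mul_nonneg (ind_nonneg _ b) (mul_nonneg hθ (hE a b))) (fun a b => mul_nonneg (ind_nonneg _ b) (mul_nonneg hθ (hE a b)))
    (fun a b => mul_nonneg (ind_nonneg _ b) (mul_nonneg hr (hE a b))) hK' hK hD
  exact h.mono fun y y' => le_of_eq (by ring)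

omit [DecidableEq X] [DecidableEq X'] [Fintype K] in
/-- ★★ **DEFECT-PIECE DEFECTS, TWISTED**: `𝔇_{pull}(E″, E′) ≤ 1_S(y)r_Ee^{−δd}`, rows `ε`, supports, smeared stair letters ⟹ `𝔇_T(M_{W′ᵀ}E″M_{W′}, M_{(W′σ)ᵀ}E′M_{W′σ}) ≤ 1_S(y)·|κ|²(r_E + 2sε)·e^{−δd}`.
[cite: Balaban1985BackgroundPropagators, Thm 3.14 pp.426–427 (template); Balaban1984PropagatorsII, (2.135) p.247] -/
theorem defectDefect_of_localGauge_tr (hW'1 : ∀ k v, (W' k v)ᵀ * W' k v = 1) (hW'2 : ∀ k v, W' k v * (W' k v)ᵀ = 1) {ε rE s δ : ℝ} (hε : 0 ≤ ε) (hrE : 0 ≤ rE) (hs : 0 ≤ s) (k : K)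
    (hTk : T = mmulOp (fun x' => (W' k x')ᵀ) ∘ₗ (mmulOp (fun x' => (St k x')ᵀ) ∘ₗ pull (liftMap π κ)) ∘ₗ mmulOp (fun x => W' k (sec x)))
    (hEin' : E'' k ∘ₗ mulOp (fun p : X' × κ => ψin' k p.1) = E'' k) (hEout : mulOp (fun p : X × κ => ψout k p.1) ∘ₗ E' k = E' k)
    (hSin : ∀ x' i, ∑ j, |(ψin' k x' • ((St k x')ᵀ - 1)) i j| ≤ s) (hSout : ∀ x' i, ∑ j, |(ψout k (π x') • ((St k x')ᵀ - 1)) i j| ≤ s)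
    (hE1 : HasMaj (BlockNorm.ofBlocks g (liftBlk blk κ)) (BlockNorm.ofBlocks g (liftBlk blk κ)) (E' k) (fun y y' => ind (S k) y * (ε * Real.exp (-(δ * g.dist y y')))))
    (hE1' : HasMaj (BlockNorm.ofBlocks g (liftBlk (blk ∘ π) κ)) (BlockNorm.ofBlocks g (liftBlk (blk ∘ π) κ)) (E'' k) (fun y y' => ind (S k) y * (ε * Real.exp (-(δ * g.dist y y')))))
    (hD : HasMaj (BlockNorm.ofBlocks g (liftBlk blk κ)) (BlockNorm.ofBlocks g (liftBlk (blk ∘ π) κ)) (idef (pull (liftMap π κ)) (pull (liftMap π κ)) (E'' k) (E' k))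
      (fun y y' => ind (S k) y * (rE * Real.exp (-(δ * g.dist y y'))))) :
    HasMaj (BlockNorm.ofBlocks g (liftBlk blk κ)) (BlockNorm.ofBlocks g (liftBlk (blk ∘ π) κ))
      (idef T T (mmulOp (fun x' => (W' k x')ᵀ) ∘ₗ E'' k ∘ₗ mmulOp (W' k)) (mmulOp (fun x => (W' k (sec x))ᵀ) ∘ₗ E' k ∘ₗ mmulOp (fun x => W' k (sec x))))
      (fun y y' => ind (S k) y * ((Fintype.card κ : ℝ) ^ 2 * (rE + s * ε + s * ε) * Real.exp (-(δ * g.dist y y')))) := by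
  have hE : ∀ y y' : g.Site, 0 ≤ Real.exp (-(δ * g.dist y y')) := fun _ _ => Real.exp_nonneg _
  have h := hasMaj_idef_conj_tr blk π sec T (W' k) (St k) (hW'1 k) (hW'2 k) hTk hs hEin' hEout hSin hSout
    (fun a b => mul_nonneg (ind_nonneg _ a) (mul_nonneg hε (hE a b))) (fun a b => mul_nonneg (ind_nonneg _ a) (mul_nonneg hε (hE a b)))
    (fun a b => mul_nonneg (ind_nonneg _ a) (mul_nonneg hrE (hE a b))) hE1' hE1 hD
  exact h.mono fun y y' => le_of_eq (by ring)

omit [DecidableEq X] [DecidableEq X'] [Fintype K] [DecidableEq κ] in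
/-- ★ **THE PARTITION-DEFECT ROW OF THE TWISTED TRANSPORT**: for `T = M_{Ψᵀ}∘pull` with `|Ψᵀ| ≤ 1` entrywise and colour-blind scalars with the flat fit `|h′ − h∘π| ≤ o`,
`𝔇_T(M_{h′}, M_h) = M_{Ψᵀ}∘𝔇_{pull}(M_{h′}, M_h) ≤ diag(|κ|·o)` — the row `hDh` of n15-c∕332. [cite: Balaban1984PropagatorsII, (2.133) p.247 (shape); King1986, p.664 (pairing)] -/
theorem hasMaj_idef_mulOp_tr {Ψ : X' → Matrix κ κ ℝ} (hT0 : T = mmulOp (fun x' => (Ψ x')ᵀ) ∘ₗ pull (liftMap π κ)) (hΨ : ∀ x' i j, |(Ψ x')ᵀ i j| ≤ 1)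
    {h : X → ℝ} {h' : X' → ℝ} {o : ℝ} (ho : 0 ≤ o) (hfit : ∀ p, |(fun p : X' × κ => h' p.1) p - (fun p : X × κ => h p.1) (liftMap π κ p)| ≤ o) :
    HasMaj (BlockNorm.ofBlocks g (liftBlk blk κ)) (BlockNorm.ofBlocks g (liftBlk (blk ∘ π) κ)) (idef T T (mulOp (fun p : X' × κ => h' p.1)) (mulOp (fun p : X × κ => h p.1)))
      (diagK fun _ => (Fintype.card κ : ℝ) * o) := by
  have e : idef T T (mulOp (fun p : X' × κ => h' p.1)) (mulOp (fun p : X × κ => h p.1)) =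
      mmulOp (fun x' => (Ψ x')ᵀ) ∘ₗ idef (pull (liftMap π κ)) (pull (liftMap π κ)) (mulOp (fun p : X' × κ => h' p.1)) (mulOp (fun p : X × κ => h p.1)) := by
    rw [hT0]
    refine LinearMap.ext fun f => funext fun p => ?_
    simp only [T4EtaRateDefect.idef_apply, LinearMap.comp_apply, mmulOp_apply, mulOp_apply, pull_apply, Pi.sub_apply, Finset.mul_sum, mul_sub,
      Finset.sum_sub_distrib]
    refine congrArg₂ _ (Finset.sum_congr rfl fun j _ => by ring) rfl
  rw [e]
  have hDM := hasMaj_idef_mulOp (g := g) (liftBlk blk κ) (liftMap π κ) (a' := fun p : X' × κ => h' p.1) (a := fun p : X × κ => h p.1) (o := fun _ => o)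
    (fun _ => ho) hfit
  have hι : 0 ≤ (Fintype.card κ : ℝ) := Nat.cast_nonneg _
  refine (hasMaj_mmulOp_comp_of_entry_le_one (blk ∘ π) (b := BlockNorm.ofBlocks g (liftBlk blk κ)) (W₀ := fun x' => (Ψ x')ᵀ) hΨ hDM).mono fun y y' => ?_
  by_cases hy : y = y'
  · subst hy; simp [diagK]
  · simp [diagK, hy]

end Pieces

/-! ## §4 The two-grid glue in per-cube gauges through the twisted transport -/

section Glue

variable {X X' κ K : Type} [Fintype X] [Fintype X'] [DecidableEq X] [DecidableEq X'] [Fintype κ] [DecidableEq κ] [Fintype K] {g : B6.Geometry}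
  (blk : X → g.Site) (π : X' → X) (sec : X → X') (S : K → Set g.Site) {σ cr : ℝ} (T : (X × κ → ℝ) →ₗ[ℝ] (X' × κ → ℝ)) (W' St : K → X' → Matrix κ κ ℝ) (Ψ : X' → Matrix κ κ ℝ)
  {Δ : (X × κ → ℝ) →ₗ[ℝ] (X × κ → ℝ)} {Δ' : (X' × κ → ℝ) →ₗ[ℝ] (X' × κ → ℝ)} {G' E' : K → (X × κ → ℝ) →ₗ[ℝ] (X × κ → ℝ)}
  {G'' E'' : K → (X' × κ → ℝ) →ₗ[ℝ] (X' × κ → ℝ)} {χX hX ψout : K → X → ℝ} {χX' hX' ψin' : K → X' → ℝ}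

/-- ★★★★ **THE TWO-GRID η-DEFECT OF THE GLUED PROPAGATOR, EACH CUBE IN ITS OWN GAUGE PAIR, THROUGH THE TWISTED TRANSPORT — NO GAUGE FIT** (dag-n15-w2's
`hasMaj_idef_glued_of_localGauges` with `pull ↦ T`, fine gauges `W′_□`, induced coarse gauges `W′_□∘σ`; n15-c∕332 `hasMaj_idef_glued_of_cutRows_defect_tr` fed by §3): the architecture
of record for (PC-E) (director-ym I.20907), generic carriers. [cite: Balaban1984PropagatorsII, (2.91) p.239, (2.133)–(2.136) p.247 (mechanism); Balaban1985BackgroundPropagators,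
(3.34)–(3.35) p.396, (3.87)–(3.90) pp.409–410, p.399, Thm 3.14 pp.426–427 (difference template); King1986, Prop. 3.9 (3.73) p.665 (η-rate shape), p.664 (pairing)] -/
theorem hasMaj_idef_glued_of_localGauges_tr (htri : Triangle254 g) (hd : ∀ a b : g.Site, 0 ≤ g.dist a b) (hd0 : ∀ y : g.Site, g.dist y y = 0) (hrow : RowSum g σ cr) (hσ : 0 ≤ σ)
    (hcr : 0 ≤ cr) (hW'1 : ∀ k v, (W' k v)ᵀ * W' k v = 1) (hW'2 : ∀ k v, W' k v * (W' k v)ᵀ = 1) {β θ₀ ε m r rE o δ Nov s : ℝ} (hβ : 0 ≤ β) (hθ : 0 ≤ θ₀) (hε : 0 ≤ ε) (hm : 0 ≤ m)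
    (hr : 0 ≤ r) (hrE : 0 ≤ rE) (ho : 0 ≤ o) (hs : 0 ≤ s) (hNov : 0 ≤ Nov) (hσδ : 2 * σ ≤ δ)
    (hcut : ∀ k, mulOp (fun p : X × κ => hX k p.1) ∘ₗ mulOp (fun p : X × κ => χX k p.1) = mulOp (fun p : X × κ => hX k p.1))
    (hcut' : ∀ k, mulOp (fun p : X' × κ => hX' k p.1) ∘ₗ mulOp (fun p : X' × κ => χX' k p.1) = mulOp (fun p : X' × κ => hX' k p.1))
    (hh : ∀ k p, |(fun p : X × κ => hX k p.1) p| ≤ 1) (hh' : ∀ k p, |(fun p : X' × κ => hX' k p.1) p| ≤ 1)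
    (hfit : ∀ k p, |(fun p : X' × κ => hX' k p.1) p - (fun p : X × κ => hX k p.1) (liftMap π κ p)| ≤ o) (hN : ∀ a, ∑ k, ind (S k) a ≤ Nov)
    -- the transport: per-cube factorization through the cube's gauge pair and stair field (n15-c∕331 `ctauV_eq_conj_gaugeTb`), and its global product form (partition row)
    (hTk : ∀ k, T = mmulOp (fun x' => (W' k x')ᵀ) ∘ₗ (mmulOp (fun x' => (St k x')ᵀ) ∘ₗ pull (liftMap π κ)) ∘ₗ mmulOp (fun x => W' k (sec x)))
    (hT0 : T = mmulOp (fun x' => (Ψ x')ᵀ) ∘ₗ pull (liftMap π κ)) (hΨ : ∀ x' i j, |(Ψ x')ᵀ i j| ≤ 1)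
    -- supports of the pieces (fine input, coarse output) and the SMEARED stair letters on them
    (hGin' : ∀ k, G'' k ∘ₗ mulOp (fun p : X' × κ => ψin' k p.1) = G'' k) (hEin' : ∀ k, E'' k ∘ₗ mulOp (fun p : X' × κ => ψin' k p.1) = E'' k)
    (hGout : ∀ k, mulOp (fun p : X × κ => ψout k p.1) ∘ₗ (mulOp (fun p : X × κ => χX k p.1) ∘ₗ G' k) = mulOp (fun p : X × κ => χX k p.1) ∘ₗ G' k)
    (hKout : ∀ k, mulOp (fun p : X × κ => ψout k p.1) ∘ₗ (commOp (mmulOp (fun x => W' k (sec x)) ∘ₗ Δ ∘ₗ mmulOp (fun x => (W' k (sec x))ᵀ)) (fun p : X × κ => hX k p.1) ∘ₗ G' k) =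
      commOp (mmulOp (fun x => W' k (sec x)) ∘ₗ Δ ∘ₗ mmulOp (fun x => (W' k (sec x))ᵀ)) (fun p : X × κ => hX k p.1) ∘ₗ G' k)
    (hEout : ∀ k, mulOp (fun p : X × κ => ψout k p.1) ∘ₗ E' k = E' k)
    (hSin : ∀ k x' i, ∑ j, |(ψin' k x' • ((St k x')ᵀ - 1)) i j| ≤ s) (hSout : ∀ k x' i, ∑ j, |(ψout k (π x') • ((St k x')ᵀ - 1)) i j| ≤ s)
    -- rows in the cubes' gauges, both grids
    (hGc : ∀ k, HasMaj (BlockNorm.ofBlocks g (liftBlk blk κ)) (BlockNorm.ofBlocks g (liftBlk blk κ)) (mulOp (fun p : X × κ => χX k p.1) ∘ₗ G' k)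
      (fun y y' => ind (S k) y * ind (S k) y' * (β * Real.exp (-(δ * g.dist y y')))))
    (hGc' : ∀ k, HasMaj (BlockNorm.ofBlocks g (liftBlk (blk ∘ π) κ)) (BlockNorm.ofBlocks g (liftBlk (blk ∘ π) κ)) (mulOp (fun p : X' × κ => χX' k p.1) ∘ₗ G'' k)
      (fun y y' => ind (S k) y * ind (S k) y' * (β * Real.exp (-(δ * g.dist y y')))))
    (hK : ∀ k, HasMaj (BlockNorm.ofBlocks g (liftBlk blk κ)) (BlockNorm.ofBlocks g (liftBlk blk κ))
      (commOp (mmulOp (fun x => W' k (sec x)) ∘ₗ Δ ∘ₗ mmulOp (fun x => (W' k (sec x))ᵀ)) (fun p : X × κ => hX k p.1) ∘ₗ G' k) (fun y y' => ind (S k) y' * (θ₀ * Real.exp (-(δ * g.dist y y')))))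
    (hK' : ∀ k, HasMaj (BlockNorm.ofBlocks g (liftBlk (blk ∘ π) κ)) (BlockNorm.ofBlocks g (liftBlk (blk ∘ π) κ))
      (commOp (mmulOp (W' k) ∘ₗ Δ' ∘ₗ mmulOp (fun x' => (W' k x')ᵀ)) (fun p : X' × κ => hX' k p.1) ∘ₗ G'' k)
      (fun y y' => ind (S k) y' * (θ₀ * Real.exp (-(δ * g.dist y y')))))
    (hE : ∀ k, HasMaj (BlockNorm.ofBlocks g (liftBlk blk κ)) (BlockNorm.ofBlocks g (liftBlk blk κ)) (E' k) (fun y y' => ind (S k) y * (ε * Real.exp (-(δ * g.dist y y')))))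
    (hE' : ∀ k, HasMaj (BlockNorm.ofBlocks g (liftBlk (blk ∘ π) κ)) (BlockNorm.ofBlocks g (liftBlk (blk ∘ π) κ)) (E'' k) (fun y y' => ind (S k) y * (ε * Real.exp (-(δ * g.dist y y')))))
    -- η-defects in the cubes' gauges
    (hDGc : ∀ k, HasMaj (BlockNorm.ofBlocks g (liftBlk blk κ)) (BlockNorm.ofBlocks g (liftBlk (blk ∘ π) κ))
      (idef (pull (liftMap π κ)) (pull (liftMap π κ)) (mulOp (fun p : X' × κ => χX' k p.1) ∘ₗ G'' k) (mulOp (fun p : X × κ => χX k p.1) ∘ₗ G' k))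
      (fun y y' => ind (S k) y * ind (S k) y' * (m * Real.exp (-(δ * g.dist y y')))))
    (hDK : ∀ k, HasMaj (BlockNorm.ofBlocks g (liftBlk blk κ)) (BlockNorm.ofBlocks g (liftBlk (blk ∘ π) κ))
      (idef (pull (liftMap π κ)) (pull (liftMap π κ))
        (commOp (mmulOp (W' k) ∘ₗ Δ' ∘ₗ mmulOp (fun x' => (W' k x')ᵀ)) (fun p : X' × κ => hX' k p.1) ∘ₗ G'' k)
        (commOp (mmulOp (fun x => W' k (sec x)) ∘ₗ Δ ∘ₗ mmulOp (fun x => (W' k (sec x))ᵀ)) (fun p : X × κ => hX k p.1) ∘ₗ G' k))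
      (fun y y' => ind (S k) y' * (r * Real.exp (-(δ * g.dist y y')))))
    (hDE : ∀ k, HasMaj (BlockNorm.ofBlocks g (liftBlk blk κ)) (BlockNorm.ofBlocks g (liftBlk (blk ∘ π) κ)) (idef (pull (liftMap π κ)) (pull (liftMap π κ)) (E'' k) (E' k))
      (fun y y' => ind (S k) y * (rE * Real.exp (-(δ * g.dist y y')))))
    (hq : Nov * ((Fintype.card κ : ℝ) ^ 2 * θ₀ + (Fintype.card κ : ℝ) ^ 2 * ε) * cr < 1) :
    HasMaj (BlockNorm.ofBlocks g (liftBlk blk κ)) (BlockNorm.ofBlocks g (liftBlk (blk ∘ π) κ))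
      (idef T T
        (glueInv (parametrix (fun k => fun p : X' × κ => hX' k p.1) (fun k => mmulOp (fun x' => (W' k x')ᵀ) ∘ₗ G'' k ∘ₗ mmulOp (W' k)))
          (remainder Δ' (fun k => fun p : X' × κ => hX' k p.1) (fun k => mmulOp (fun x' => (W' k x')ᵀ) ∘ₗ G'' k ∘ₗ mmulOp (W' k)) -
            ∑ k, (mmulOp (fun x' => (W' k x')ᵀ) ∘ₗ E'' k ∘ₗ mmulOp (W' k)) ∘ₗ mulOp (fun p : X' × κ => hX' k p.1)))
        (glueInv (parametrix (fun k => fun p : X × κ => hX k p.1) (fun k => mmulOp (fun x => (W' k (sec x))ᵀ) ∘ₗ G' k ∘ₗ mmulOp (fun x => W' k (sec x))))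
          (remainder Δ (fun k => fun p : X × κ => hX k p.1) (fun k => mmulOp (fun x => (W' k (sec x))ᵀ) ∘ₗ G' k ∘ₗ mmulOp (fun x => W' k (sec x))) -
            ∑ k, (mmulOp (fun x => (W' k (sec x))ᵀ) ∘ₗ E' k ∘ₗ mmulOp (fun x => W' k (sec x))) ∘ₗ mulOp (fun p : X × κ => hX k p.1))))
      (fun y y' => (Nov * ((Fintype.card κ : ℝ) ^ 2 * β) * ((1 - Nov * (((Fintype.card κ : ℝ) ^ 2 * θ₀) + ((Fintype.card κ : ℝ) ^ 2 * ε)) * cr)⁻¹ * ((1 - Nov * (((Fintype.card κ : ℝ) ^ 2 * θ₀) + ((Fintype.card κ : ℝ) ^ 2 * ε)) * cr)⁻¹ * (Nov * (((Fintype.card κ : ℝ) ^ 2 * θ₀) * ((Fintype.card κ : ℝ) * o) + ((Fintype.card κ : ℝ) ^ 2 * (r + s * θ₀ + s * θ₀)) + (((Fintype.card κ : ℝ) ^ 2 * ε) * ((Fintype.card κ : ℝ) * o) + ((Fintype.card κ : ℝ) ^ 2 * (rE + s * ε + s * ε))))) * cr) * cr) * cr +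
        Nov * (2 * ((Fintype.card κ : ℝ) ^ 2 * β) * ((Fintype.card κ : ℝ) * o) + ((Fintype.card κ : ℝ) ^ 2 * (m + s * β + s * β))) * (1 - Nov * (((Fintype.card κ : ℝ) ^ 2 * θ₀) + ((Fintype.card κ : ℝ) ^ 2 * ε)) * cr)⁻¹ * cr) * Real.exp (-((δ - 2 * σ) * g.dist y y'))) := by
  exact hasMaj_idef_glued_of_cutRows_defect_tr (liftBlk blk κ) (liftMap π κ) S T htri hd hd0 hrow hσ hcr (by positivity) (by positivity) (by positivity) (by positivity) (by positivity)
    (by positivity) (by positivity) hNov hσδ hcut hcut' hh hh' (fun k => hasMaj_idef_mulOp_tr blk π T hT0 hΨ ho (hfit k)) hN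
    (fun k => cutRow_of_localGauge blk S (fun k x => W' k (sec x)) χX G' (fun k x => hW'2 k (sec x)) (fun k x => hW'1 k (sec x)) hβ k (hGc k))
    (fun k => cutRow_of_localGauge (blk ∘ π) S W' χX' G'' hW'2 hW'1 hβ k (hGc' k))
    (fun k => commRow_of_localGauge blk S (fun k x => W' k (sec x)) Δ hX G' (fun k x => hW'2 k (sec x)) (fun k x => hW'1 k (sec x)) hθ k (hK k))
    (fun k => commRow_of_localGauge (blk ∘ π) S W' Δ' hX' G'' hW'2 hW'1 hθ k (hK' k))
    (fun k => defectRow_of_localGauge blk S (fun k x => W' k (sec x)) E' (fun k x => hW'2 k (sec x)) (fun k x => hW'1 k (sec x)) hε k (hE k))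
    (fun k => defectRow_of_localGauge (blk ∘ π) S W' E'' hW'2 hW'1 hε k (hE' k))
    (fun k => cutDefect_of_localGauge_tr blk π sec S T W' St hW'1 hW'2 hβ hm hs k (hTk k) (hGin' k) (hGout k) (hSin k) (hSout k) (hGc k) (hGc' k) (hDGc k))
    (fun k => commDefect_of_localGauge_tr blk π sec S T W' St hW'1 hW'2 hθ hr hs k (hTk k) (hGin' k) (hKout k) (hSin k) (hSout k) (hK k) (hK' k) (hDK k))
    (fun k => defectDefect_of_localGauge_tr blk π sec S T W' St hW'1 hW'2 hε hrE hs k (hTk k) (hEin' k) (hEout k) (hSin k) (hSout k) (hE k) (hE' k) (hDE k)) hq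

end Glue

end Summit.QuantumFields.YangMills.BalabanUVNodes.N15.CurvedSpecies

end
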